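import Summits.QuantumFields.BalabanUV.Beta.D1BFx.PackedDictionaryLetters

/-!
# `BalabanUV.Beta.D1BFx.PackedBlockGlue` — road «BF-x» for binder row D1, slot (K), chain step (I) «(A1)-PACKED», brick (B3) PART 1c «BLOCK GLUE»
# (`A1-PACKED-SPEC.md` v0.4 §9, PART 3 prep): **BLOCK READ-OUTS COMMUTE WITH RESPONSE PACKING** — the ff ∕ fm ∕ mf ∕ mm blocks of a packed sum of
# periodised sorted tables are the packed sums of the blocks; hence, with PART 1, the parity-typed jets `kₛ := ff̂(arr s 𝒱)`, `qₛ := m̂f(arr s 𝒱)` of the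
# stripped identity ARE the packed sums `Σ_k rₛ k • ff̂(arr s (S κ′_k ŵ_k))`, `Σ_k rₛ k • m̂f(…)` over the torus' fine bonds — the shape in which PART 2a∕2b
# (`packed_ward₁_field`, `packed_ward₂_field`) deliver the Ward letters (`K₁ (inl k) := ff̂_k`, `Q₁ (inl k) := m̂f_k`).

HONEST DEPENDENCY (cell records, verbatim): «continuum YM on T⁴ ⇐ BetaPertH ∧ nine spine estimates (0/9 proved); BetaPertH ⇐ (D1) ∧ (D4) ∧
CAP+tail; G-an2-4 gates asym, D1 and NE2/3/4.»  HONEST FRAMING (cell contract, verbatim): «discharging `BetaPertH` makes Bałaban's UV stability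
UNCONDITIONAL — a real constructive-QFT result; it is NOT the continuum limit and NOT the Clay problem.»  THIS MODULE DISCHARGES NOTHING of (K),
of D1 or of the wall: [folklore] finite linear algebra of `Matrix.fromBlocks` over TA1's `SortedKernels.blocksHat` + PART 1 BY NAME.  No definition,
no `def … : Prop`, nothing cited, 0 sorry.  NOT D1, NOT `BetaPertH`, NOT continuum, NOT Clay.

ABSOLUTE RULE (cell charter, verbatim): «No internally-minted statement may enter as a cited fact. Every hypothesis is either kernel-proved in this
package or a verbatim quotation of a PUBLISHED theorem with page reference. The manuscript(s) under audit are NOT citable for their own disputed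
steps — they are the thing under adjudication; programme-internal (2001/route/tribunal) claims are never citable.»

CONTENT (all [folklore]).
* §1 `sum_smul_fromBlocks` (generic), **`sum_smul_blocksHat`** (`Σ_k r k • blocksHat p (K k) = fromBlocks (Σ r•TL̂) (Σ r•TR̂) (Σ r•BL̂) (Σ r•BR̂)`),
  **`blocks_of_blocksHat_eq_sum`** (a periodised sorted kernel that equals a packed sum has every block equal to the packed sum of the blocks — `Matrix.fromBlocks_inj`).
* §2 ON THE TORUS (PART 1 BY NAME): **`ffHat_packed_first`**, **`mfHat_packed_first`** — `ff̂(arr s (vertexOfK G₀ n S μ ŷ)) = Σ_k r_{(ȳ,μ)} k • ff̂(arr s (S κ′_k ŵ_k))` and the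
  mf block likewise (the jets `kₛ`, `qₛ` of the stripped identity in PART 2a's shape).
* §3 `tsum_colH_add_period_smul`, **`response_siteOf_eq_tsum_colH`** — the torus response at the coarse bond `(siteOf p z, ν)` has the p-FREE weight `colH G₀ n ν z`
  for EVERY `p` (coarse-representative invariance by block covariance; the response letters `hrₛ`∕`hrₜ` of leaf-03's `PackedTowerCombine`).
Unit `b2b-balaban-beta-d1-p2` (road owner, gen 17), 2026-08-22.
-/

noncomputable section

namespace Summit.QuantumFields.BalabanUV.Beta.D1BFx.PackedBlockGlue

open Matrix
open scoped BigOperators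
open Literature.Probability.LatticeModels (TorusSite)
open Literature.MathematicalPhysics.QuantumFieldTheory.Balaban1983to89
open Literature.MathematicalPhysics.QuantumFieldTheory.Balaban1983to89.Beta
open Literature.MathematicalPhysics.QuantumFieldTheory.Balaban1983to89.Beta.Composition (kkt)
open ExpKernelCalculus (MKer shiftK)
open AffineAveraging (box toSite)
open OneStepResolventKernel (Fib LocStencil)
open OneStepKernelFamily (KInvStep vertexOfK colH)
open Summit.QuantumFields.BalabanUV.Beta.AxialDressingRooted (coDressKBmAt shiftK_coDressKBmAt_KInvStep)
open Summit.QuantumFields.BalabanUV.Beta.D1BFx.FibredPeriodisation (FKer periodiseF)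
open Summit.QuantumFields.BalabanUV.Beta.D1BFx.SortedKernels (blocksHat fTL fTR fBL fBR)
open Summit.QuantumFields.BalabanUV.Beta.D1BFx.SortedReblocking (torusBlockEquiv exists_windowMap_siteOf)
open Summit.QuantumFields.BalabanUV.Beta.D1BFx.SortedPack (sortK)
open Summit.QuantumFields.BalabanUV.Beta.D1BFx.TorusCombKKT (I J CombRows tauT Khat Qhat)
open Summit.QuantumFields.BalabanUV.Beta.D1BFx.PeriodicArrays (arr)
open Summit.QuantumFields.BalabanUV.Beta.D1BFx.PackedDictionaryLetters (packed_first_letter)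
open Summit.QuantumFields.BalabanUV.Beta.D1BFx.PackedResponseTorus (response_inl_eq_tsum_colH_window)

/-! ## §1 Block read-outs commute with packing -/

section Blocks

variable {α β ι : Type*} [Fintype ι]

/-- [folklore] A weighted finite sum of block matrices is the block matrix of the weighted sums. -/
theorem sum_smul_fromBlocks (r : ι → ℝ) (A : ι → Matrix α α ℝ) (B : ι → Matrix α β ℝ) (C : ι → Matrix β α ℝ) (D : ι → Matrix β β ℝ) :
    (∑ k, r k • Matrix.fromBlocks (A k) (B k) (C k) (D k))
      = Matrix.fromBlocks (∑ k, r k • A k) (∑ k, r k • B k) (∑ k, r k • C k) (∑ k, r k • D k) := by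
  ext i j
  rw [Matrix.sum_apply]
  rcases i with i | i <;> rcases j with j | j <;>
    simp only [Matrix.fromBlocks_apply₁₁, Matrix.fromBlocks_apply₁₂, Matrix.fromBlocks_apply₂₁, Matrix.fromBlocks_apply₂₂, Matrix.smul_apply,
      Matrix.sum_apply]

variable {d : ℕ} {γ δ' : Type*} (s : ℕ) [NeZero s]

/-- [folklore] **BLOCK READ-OUTS COMMUTE WITH PACKING**: `Σ_k r k • blocksHat s (K k) = fromBlocks (Σ_k r k • TL̂_k) (Σ_k r k • TR̂_k) (Σ_k r k • BL̂_k) (Σ_k r k • BR̂_k)`. -/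
theorem sum_smul_blocksHat (r : ι → ℝ) (K : ι → FKer (d + 1) (γ ⊕ δ') (γ ⊕ δ')) :
    (∑ k, r k • blocksHat s (K k))
      = Matrix.fromBlocks (∑ k, r k • Matrix.of (periodiseF s (fTL (K k)))) (∑ k, r k • Matrix.of (periodiseF s (fTR (K k))))
          (∑ k, r k • Matrix.of (periodiseF s (fBL (K k)))) (∑ k, r k • Matrix.of (periodiseF s (fBR (K k)))) := by
  simp only [blocksHat]
  exact sum_smul_fromBlocks r _ _ _ _

/-- [folklore] **THE BLOCKS OF A PACKED IDENTITY**: if `blocksHat s W = Σ_k r k • blocksHat s (K k)` then each of the four periodised blocks of `W` is the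
packed sum of the corresponding blocks of the `K k` (`Matrix.fromBlocks_inj`). -/
theorem blocks_of_blocksHat_eq_sum (r : ι → ℝ) (W : FKer (d + 1) (γ ⊕ δ') (γ ⊕ δ')) (K : ι → FKer (d + 1) (γ ⊕ δ') (γ ⊕ δ'))
    (h : blocksHat s W = ∑ k, r k • blocksHat s (K k)) :
    Matrix.of (periodiseF s (fTL W)) = ∑ k, r k • Matrix.of (periodiseF s (fTL (K k)))
      ∧ Matrix.of (periodiseF s (fTR W)) = ∑ k, r k • Matrix.of (periodiseF s (fTR (K k)))
      ∧ Matrix.of (periodiseF s (fBL W)) = ∑ k, r k • Matrix.of (periodiseF s (fBL (K k)))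
      ∧ Matrix.of (periodiseF s (fBR W)) = ∑ k, r k • Matrix.of (periodiseF s (fBR (K k))) := by
  rw [sum_smul_blocksHat, blocksHat] at h
  exact Matrix.fromBlocks_inj.1 h

end Blocks

/-! ## §2 On the torus: the parity-typed jets of the stripped identity ARE packed sums of per-bond blocks -/

section Torus

variable {d : ℕ} {n : ℕ} [NeZero n] {r : Fin (d + 1) → ℕ} (hr : r ∈ box (d + 1) n) (p : ℕ) [NeZero p]
include hr

/-- [folklore] **THE ff JET IS PACKED**: `ff̂(arr (n·p) (vertexOfK G₀ n S μ ŷ)) = Σ_{k : I d n p} M_T⁻¹ (inl k) (inr (inl (ȳ,μ))) • ff̂(arr (n·p) (S κ′_k ŵ_k))` — the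
antisymmetric form jet `kₛ` of the stripped identity (PART 1 `packed_first_kkt`∕`packed_first_parity`) in the shape PART 2a's `packed_ward₁_field` delivers its Ward
letter for (`K₁ (inl k) := ff̂(arr (n·p) (S κ′_k ŵ_k))`). -/
theorem ffHat_packed_first {S : Fin (d + 1) → (Fin (d + 1) → ℤ) → MKer (d + 1) (Fib d)} {Cs δ : ℝ} (hS : LocStencil S Cs δ) (hCs : 0 ≤ Cs)
    (hδ : 0 < δ) (hScov : ∀ κ' u v, S κ' (u + v) = shiftK (-v) (S κ' u)) (ybar : Beta.Site (d + 1) p) (μ : Fin (d + 1)) :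
    Matrix.of (periodiseF p (fTL (sortK n (arr (n * p) (vertexOfK (coDressKBmAt (toSite r) n (KInvStep (d := d) n 0)) n S μ (windowMap (d + 1) p ybar))))))
      = ∑ k : I d n p,
          (kkt (Khat (d := d) n p) (Matrix.fromRows (Qhat (d := d) n p) (tauT (toSite r) n p)))⁻¹ (Sum.inl k) (Sum.inr (Sum.inl (ybar, μ)))
            • Matrix.of (periodiseF p (fTL (sortK n (arr (n * p) (S k.2.2 (windowMap (d + 1) (n * p) (torusBlockEquiv n p (k.1, k.2.1)))))))) :=
  (blocks_of_blocksHat_eq_sum p _ _ _ (packed_first_letter hr p hS hCs hδ hScov ybar μ)).1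

/-- [folklore] **THE mf (CONSTRAINT) JET IS PACKED**: the same for the mf block — the constraint jet `qₛ` of the stripped identity (`Q₁ (inl k) := m̂f(…)`). -/
theorem mfHat_packed_first {S : Fin (d + 1) → (Fin (d + 1) → ℤ) → MKer (d + 1) (Fib d)} {Cs δ : ℝ} (hS : LocStencil S Cs δ) (hCs : 0 ≤ Cs)
    (hδ : 0 < δ) (hScov : ∀ κ' u v, S κ' (u + v) = shiftK (-v) (S κ' u)) (ybar : Beta.Site (d + 1) p) (μ : Fin (d + 1)) :
    Matrix.of (periodiseF p (fBL (sortK n (arr (n * p) (vertexOfK (coDressKBmAt (toSite r) n (KInvStep (d := d) n 0)) n S μ (windowMap (d + 1) p ybar))))))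
      = ∑ k : I d n p,
          (kkt (Khat (d := d) n p) (Matrix.fromRows (Qhat (d := d) n p) (tauT (toSite r) n p)))⁻¹ (Sum.inl k) (Sum.inr (Sum.inl (ybar, μ)))
            • Matrix.of (periodiseF p (fBL (sortK n (arr (n * p) (S k.2.2 (windowMap (d + 1) (n * p) (torusBlockEquiv n p (k.1, k.2.1)))))))) :=
  (blocks_of_blocksHat_eq_sum p _ _ _ (packed_first_letter hr p hS hCs hδ hScov ybar μ)).2.2.1

end Torus

/-! ## §3 Coarse-representative invariance of the torus response's weight -/

section Representative

variable {d : ℕ} {n : ℕ} [NeZero n] {r : Fin (d + 1) → ℕ} (hr : r ∈ box (d + 1) n) (p : ℕ) [NeZero p]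
include hr

omit [NeZero n] [NeZero p] hr in
/-- [folklore] The periodised `ℋ`-column of a BLOCK-COVARIANT pack does not see a period multiple added to the coarse site:
`Σ'_m colH K n ν (z + p·t₀) κ′ (ŵ + (n·p)·m) = Σ'_m colH K n ν z κ′ (ŵ + (n·p)·m)` (`shiftK (−n•t) K = K`; re-index `m ↦ m − t₀`, `Equiv.subRight`). -/
theorem tsum_colH_add_period_smul (K : MKer (d + 1) (Fib d)) (hcov : ∀ t : Fin (d + 1) → ℤ, shiftK (-((n : ℤ) • t)) K = K)
    (ν κ' : Fin (d + 1)) (z t₀ what : Fin (d + 1) → ℤ) :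
    ∑' m : Fin (d + 1) → ℤ, colH K n ν (z + (p : ℤ) • t₀) κ' (imageShift (n * p) what m)
      = ∑' m : Fin (d + 1) → ℤ, colH K n ν z κ' (imageShift (n * p) what m) := by
  rw [← (Equiv.subRight t₀).tsum_eq (fun m => colH K n ν z κ' (imageShift (n * p) what m))]
  refine tsum_congr fun m => ?_
  simp only [Equiv.subRight_apply, colH]
  -- block covariance by `n • (p • t₀)`
  have h := congrFun (congrFun (congrFun (congrFun (hcov ((p : ℤ) • t₀)) (imageShift (n * p) what m))
    ((n : ℤ) • (z + (p : ℤ) • t₀))) (Sum.inl κ')) (Sum.inr ν)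
  simp only [shiftK] at h
  have e1 : imageShift (n * p) what m + -((n : ℤ) • ((p : ℤ) • t₀)) = imageShift (n * p) what (m - t₀) := by
    funext i; simp only [imageShift, Pi.add_apply, Pi.neg_apply, Pi.sub_apply, Pi.smul_apply, smul_eq_mul, Nat.cast_mul]; ring
  have e2 : (n : ℤ) • (z + (p : ℤ) • t₀) + -((n : ℤ) • ((p : ℤ) • t₀)) = (n : ℤ) • z := by
    rw [smul_add, add_neg_cancel_right]
  rw [e1, e2] at h
  exact h.symm

/-- [folklore] **COARSE-REPRESENTATIVE INVARIANCE OF THE TORUS RESPONSE** (the one line (B3) PART 3 owes leaf-03's `PackedTowerCombine` for the p-FREE response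
letters `hrₛ`∕`hrₜ`): at the torus coarse bond `(siteOf p z, ν)` of ANY `ℤ^{d+1}` coarse site `z`,
`M_T⁻¹ (inl k) (inr (inl (siteOf p z, ν))) = Σ'_m colH G₀ n ν z κ′_k (ŵ_k + (n·p)·m)` — with the p-FREE weight `colH G₀ n ν z` (not `colH G₀ n ν (windowMap p (siteOf p z))`),
for EVERY `p` (no «`z` in the window» needed): (B4b) + `exists_windowMap_siteOf` + `tsum_colH_add_period_smul`. -/
theorem response_siteOf_eq_tsum_colH (z : Fin (d + 1) → ℤ) (ν : Fin (d + 1)) (k : I d n p) :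
    (kkt (Khat (d := d) n p) (Matrix.fromRows (Qhat (d := d) n p) (tauT (toSite r) n p)))⁻¹ (Sum.inl k) (Sum.inr (Sum.inl (siteOf (d + 1) p z, ν)))
      = ∑' m : Fin (d + 1) → ℤ, colH (coDressKBmAt (toSite r) n (KInvStep (d := d) n 0)) n ν z k.2.2
          (imageShift (n * p) (windowMap (d + 1) (n * p) (torusBlockEquiv n p (k.1, k.2.1))) m) := by
  obtain ⟨zbar, zhat, κ'⟩ := k
  rw [response_inl_eq_tsum_colH_window hr p (siteOf (d + 1) p z) ν zbar zhat κ']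
  obtain ⟨t₀, ht⟩ := exists_windowMap_siteOf (p := p) z
  rw [ht]
  exact tsum_colH_add_period_smul p _ (fun t => shiftK_coDressKBmAt_KInvStep (toSite r) 0 t) ν κ' z t₀ _

end Representative

end Summit.QuantumFields.BalabanUV.Beta.D1BFx.PackedBlockGlue

end
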